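import Literature.NumberTheory.EllipticCurves.PAdicLFunctionTameProofs
import HarnessLib

/-!
# The tame-level Mazur–Swinnerton-Dyer measure: the DISTRIBUTION RELATION in the `p`-direction
# (Mazur–Tate–Teitelbaum §I.10 (10.2)) IN THE KERNEL — discharge of the named fact
# `msdMeasureTame_distribution` (PROOFS ONLY: no `def`, no named fact)

Companion of `Literature.NumberTheory.EllipticCurves.PAdicLFunctionTame` (p534793; cell bsd-2adic, seat conv-1, planner
RULING RC-159 road P2) and of `PAdicLFunctionTameProofs` (Matsuno 2000 Lemma 2.2). For a rational normalised newform `f`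
of level `N` prime to `p`, `(m, p) = 1`, `a_p(f) = a_p`, `α ≠ 0` with `α² − a_p α + p = 0`:
`∑_{a' ↦ a} μ_{f,α,m}((a' + pⁿ⁺¹ℤ_p) × {b}) = μ_{f,α,m}((a + pⁿℤ_p) × {b})`, UNIFORMLY in `n` (the uniform formula of
`msdMeasureTame` needs no case split, unlike `sum_fiber_msdMeasure_succ_eq` at `m = 1`): the fibre of `ℤ/pⁿ⁺¹ → ℤ/pⁿ`
over `a` is the set of lifts `c + pⁿmu` (`u < p`) of the Chinese-remainder representative `c` of `(a, b)`
(`filter_castHom_succ_eq_image_plift`, by cardinality against the tree's `filter_castHom_eq_image`), the lifted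
fractions are `(x + u)/p` with `x = c/(pⁿm)`, the Hecke relation at `p` (`intCast_mul_ratPlusSymbol`, MTT (4.2)) gives
`∑_u [(x+u)/p]⁺ = a_p[x]⁺ − [px]⁺`, `∑_u [x+u]⁺ = p[x]⁺`, and `α⁻¹a_p − pα⁻² = 1`.
**`msdMeasureTame_distribution_holds`** discharges the named fact (rationality from `ratCast_ratPlusSymbol_holds`).

References: B. Mazur, J. Tate, J. Teitelbaum, Invent. Math. 84 (1986), §I.10 (10.1)–(10.2) (pp. 12–13), §I.4 (4.2)
[MazurTateTeitelbaum1986Invent]; B. Mazur, P. Swinnerton-Dyer, Invent. Math. 25 (1974), §8 [MazurSwinnertonDyer1974Invent].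
-/

noncomputable section

open scoped MatrixGroups ModularForm

open CongruenceSubgroup Filter Topology Literature.NumberTheory.EllipticCurves.ModularForms

namespace Literature.NumberTheory.EllipticCurves

/-- Two naturals with the same residues mod `pᵏ` and mod `m` (coprime) agree mod `pᵏm`. [folklore] -/
private theorem intCast_dvd_sub_of_natCast_eq' {p m k : ℕ} (hmp : m.Coprime p) {c c' : ℕ}
    (h1 : (c : ZMod (p ^ k)) = c') (h2 : (c : ZMod m) = c') :
    ((p ^ k * m : ℕ) : ℤ) ∣ (c : ℤ) - c' := by
  have h1' : c ≡ c' [MOD p ^ k] := (ZMod.natCast_eq_natCast_iff _ _ _).mp h1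
  have h2' : c ≡ c' [MOD m] := (ZMod.natCast_eq_natCast_iff _ _ _).mp h2
  have h : c ≡ c' [MOD p ^ k * m] :=
    (Nat.modEq_and_modEq_iff_modEq_mul (hmp.symm.pow_left k)).mp ⟨h1', h2'⟩
  exact Nat.modEq_iff_dvd.mp h.symm

section Distribution

variable {p m n : ℕ} [Fact p.Prime]

/-- The `p` lifts `c + pⁿ m u (mod pⁿ⁺¹)`, `u < p`, are distinct (`m` a unit mod `p`): the `p` compact opens of
`ℤ_{p,m}` above `(a + pⁿℤ_p) × {b}`. [cite: MazurTateTeitelbaum1986Invent, §I.10 (pp. 12–13)] -/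
theorem plift_injective (hmp : m.Coprime p) (c : ℕ) :
    Function.Injective (fun u : Fin p => ((c + p ^ n * m * (u : ℕ) : ℕ) : ZMod (p ^ (n + 1)))) := by
  intro u u' h
  have hp : p.Prime := Fact.out
  -- reduce mod p^{n+1} ∣-divisibility to a statement mod p after cancelling pⁿ
  have hmod : (c + p ^ n * m * (u : ℕ)) ≡ (c + p ^ n * m * (u' : ℕ)) [MOD p ^ (n + 1)] :=
    (ZMod.natCast_eq_natCast_iff _ _ _).mp h
  have hmod' : p ^ n * (m * (u : ℕ)) ≡ p ^ n * (m * (u' : ℕ)) [MOD p ^ n * p] := by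
    rw [← pow_succ, ← mul_assoc, ← mul_assoc]
    exact Nat.ModEq.add_left_cancel' c hmod
  have hmod'' : m * (u : ℕ) ≡ m * (u' : ℕ) [MOD p] :=
    Nat.ModEq.mul_left_cancel' (pow_ne_zero n hp.ne_zero) hmod'
  have hu : (u : ℕ) ≡ u' [MOD p] :=
    Nat.ModEq.cancel_left_of_coprime (by simpa [Nat.coprime_comm] using hmp.symm) hmod''
  exact Fin.ext (by
    have := hu
    rw [Nat.ModEq, Nat.mod_eq_of_lt u.isLt, Nat.mod_eq_of_lt u'.isLt] at this
    exact this)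

/-- The fibre of `ℤ/pⁿ⁺¹ → ℤ/pⁿ` over `a` is the set of lifts `c + pⁿ m u`, `u < p`, of the Chinese-remainder
representative `c` of `(a, b)` (`m` a unit mod `p`; cardinality against `filter_castHom_eq_image`).
[cite: MazurTateTeitelbaum1986Invent, §I.10 (pp. 12–13)] -/
theorem filter_castHom_succ_eq_image_plift [NeZero m] (hmp : m.Coprime p) (a : ZMod (p ^ n)) (b : ZMod m) :
    Finset.univ.filter (fun a' : ZMod (p ^ (n + 1)) =>
        ZMod.castHom (pow_dvd_pow p n.le_succ) (ZMod (p ^ n)) a' = a) =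
      Finset.univ.image (fun u : Fin p => ((tameRep p m n a b + p ^ n * m * (u : ℕ) : ℕ) : ZMod (p ^ (n + 1)))) := by
  classical
  have hp : p.Prime := Fact.out
  haveI : NeZero (p ^ n) := ⟨pow_ne_zero _ hp.ne_zero⟩
  haveI : NeZero (p ^ (n + 1)) := ⟨pow_ne_zero _ hp.ne_zero⟩
  set c := tameRep p m n a b with hc
  have hca : (c : ZMod (p ^ n)) = a := natCast_tameRep_left hp hmp a b
  -- both sides have `p` elements and the image lies in the fibre: conclude by cardinality
  refine (Finset.eq_of_subset_of_card_le (fun a' ha' => ?_) ?_).symm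
  · obtain ⟨u, -, rfl⟩ := Finset.mem_image.mp ha'
    simp only [Finset.mem_filter, Finset.mem_univ, true_and, map_natCast]
    rw [Nat.cast_add, Nat.cast_mul, Nat.cast_mul, ZMod.natCast_self, zero_mul, zero_mul, add_zero, hca]
  · rw [Finset.card_image_of_injective _ (plift_injective (n := n) hmp c), Finset.card_univ, Fintype.card_fin,
      filter_castHom_eq_image, Finset.card_image_of_injective _ ?_, Finset.card_univ, Fintype.card_fin]
    intro j j' h
    have hv := congr_arg ZMod.val h
    simp only [val_classLift] at hv
    exact Fin.ext (Nat.eq_of_mul_eq_mul_left (pow_pos hp.pos n) (by omega))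

variable {N : ℕ} [NeZero N] (f : CuspForm (Gamma0 N) 2)

/-- **The distribution relation at tame level `m`** (MTT §I.10 Prop. (10.2)): for a rational normalised newform
`f` of level `N` prime to `p`, `(m, p) = 1`, `a_p(f) = a_p`, `α ≠ 0` with `α² − a_p α + p = 0`:
`∑_{a' ↦ a} μ_{f,α,m}((a' + pⁿ⁺¹ℤ_p) × {b}) = μ_{f,α,m}((a + pⁿℤ_p) × {b})` — uniformly in `n` (no case split): the
`p` lifted fractions are `(x + u)/p`, `x = c/(pⁿm)`, the Hecke relation at `p` gives `∑_u [(x+u)/p]⁺ = a_p[x]⁺ − [px]⁺`,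
`∑_u [x + u]⁺ = p[x]⁺`, and `α⁻¹a_p − pα⁻² = 1`. [cite: MazurTateTeitelbaum1986Invent, §I.10 Prop. (10.2) (p. 13)] -/
theorem sum_filter_msdMeasureTame_succ [NeZero m] (hf : IsNewform0 f)
    (hrat : ∀ r : ℚ, (ratPlusSymbol f r : ℝ) = normalizedPlusSymbol f r) (hpN : ¬ p ∣ N) (hmp : m.Coprime p)
    {ap : ℤ} (hap : cuspCoeff f p = ap) {α : ℚ_[p]} (hα₀ : α ≠ 0) (hα : α ^ 2 - ap * α + p = 0)
    (n : ℕ) (a : ZMod (p ^ n)) (b : ZMod m) :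
    ∑ a' ∈ Finset.univ.filter (fun a' : ZMod (p ^ (n + 1)) =>
        ZMod.castHom (pow_dvd_pow p n.le_succ) (ZMod (p ^ n)) a' = a), msdMeasureTame f m α (n + 1) a' b =
      msdMeasureTame f m α n a b := by
  classical
  have hp : p.Prime := Fact.out
  haveI : NeZero (p ^ (n + 1)) := ⟨pow_ne_zero _ hp.ne_zero⟩
  have hM1 : p ^ (n + 1) * m ≠ 0 := mul_ne_zero (pow_ne_zero _ hp.ne_zero) (NeZero.ne m)
  have hp0 : (p : ℚ) ≠ 0 := by exact_mod_cast hp.ne_zero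
  have hpn0 : (p : ℚ) ^ n ≠ 0 := pow_ne_zero _ hp0
  have hm0 : (m : ℚ) ≠ 0 := by exact_mod_cast (NeZero.ne m)
  set c := tameRep p m n a b with hc
  set x : ℚ := tameFraction p m n a b with hx
  rw [filter_castHom_succ_eq_image_plift hmp a b,
    Finset.sum_image fun u _ u' _ h => plift_injective (n := n) hmp c h]
  -- each lifted fraction is `(x + u)/p` mod `ℤ` (`k = 1`) and `p·` it is `x + u` (`k = p`)
  have hfrac : ∀ u : Fin p, ∀ k : ℕ, ratPlusSymbol f ((k : ℚ) *
      tameFraction p m (n + 1) ((c + p ^ n * m * (u : ℕ) : ℕ) : ZMod (p ^ (n + 1))) b) =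
      ratPlusSymbol f ((k : ℚ) * (((c + p ^ n * m * (u : ℕ) : ℕ) : ℚ) / ((p : ℚ) ^ (n + 1) * m))) := by
    intro u k
    set a' : ZMod (p ^ (n + 1)) := ((c + p ^ n * m * (u : ℕ) : ℕ) : ZMod (p ^ (n + 1))) with ha'
    set c' := tameRep p m (n + 1) a' b with hc'
    have h1 : (c' : ZMod (p ^ (n + 1))) = ((c + p ^ n * m * (u : ℕ) : ℕ) : ZMod (p ^ (n + 1))) := by
      rw [hc', natCast_tameRep_left hp hmp]
    have h2 : (c' : ZMod m) = ((c + p ^ n * m * (u : ℕ) : ℕ) : ZMod m) := by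
      rw [hc', natCast_tameRep_right hmp, Nat.cast_add, hc, natCast_tameRep_right hmp]
      push_cast
      rw [ZMod.natCast_self, mul_zero, zero_mul, add_zero]
    have hdvd := intCast_dvd_sub_of_natCast_eq' (k := n + 1) hmp h1 h2
    have hL : (k : ℚ) * tameFraction p m (n + 1) a' b = (k : ℚ) * (((c' : ℤ) : ℚ) / ((p ^ (n + 1) * m : ℕ) : ℚ)) := by
      rw [tameFraction, ← hc']
      push_cast
      ring
    have hR : (k : ℚ) * (((c + p ^ n * m * (u : ℕ) : ℕ) : ℚ) / ((p : ℚ) ^ (n + 1) * m)) =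
        (k : ℚ) * ((((c + p ^ n * m * (u : ℕ) : ℕ) : ℤ) : ℚ) / ((p ^ (n + 1) * m : ℕ) : ℚ)) := by
      push_cast
      ring
    rw [hL, hR]
    exact ratPlusSymbol_mul_div_eq_of_dvd_sub f hM1 hdvd k
  have hone : ∀ u : Fin p, ratPlusSymbol f
      (tameFraction p m (n + 1) ((c + p ^ n * m * (u : ℕ) : ℕ) : ZMod (p ^ (n + 1))) b) =
      ratPlusSymbol f ((x + u) / p) := by
    intro u
    have h := hfrac u 1
    rw [Nat.cast_one, one_mul, one_mul] at h
    rw [h, hx, tameFraction]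
    congr 1
    push_cast
    field_simp
    ring
  have hpee : ∀ u : Fin p, ratPlusSymbol f ((p : ℚ) *
      tameFraction p m (n + 1) ((c + p ^ n * m * (u : ℕ) : ℕ) : ZMod (p ^ (n + 1))) b) =
      ratPlusSymbol f x := by
    intro u
    rw [hfrac u p]
    have : (p : ℚ) * (((c + p ^ n * m * (u : ℕ) : ℕ) : ℚ) / ((p : ℚ) ^ (n + 1) * m)) = x + ((u : ℕ) : ℤ) := by
      rw [hx, tameFraction]
      push_cast
      field_simp
      ring
    rw [this, ratPlusSymbol_add_intCast_eq]
  have hHecke := intCast_mul_ratPlusSymbol p hf hp hpN hap hrat x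
  have hkey : α⁻¹ * (ap : ℚ_[p]) - (p : ℚ_[p]) * α⁻¹ ^ 2 = 1 := by
    field_simp
    linear_combination -hα
  have hsumq : ∑ u : Fin p, ratPlusSymbol f ((x + u) / p) =
      (ap : ℚ) * ratPlusSymbol f x - ratPlusSymbol f (p * x) := eq_sub_of_add_eq hHecke.symm
  simp only [msdMeasureTame, hone, hpee, Finset.sum_sub_distrib, ← Finset.mul_sum]
  rw [← Rat.cast_sum, hsumq, Finset.sum_const, Finset.card_univ, Fintype.card_fin, nsmul_eq_mul, ← hx]
  push_cast
  linear_combination (α⁻¹ ^ n * (ratPlusSymbol f x : ℚ_[p])) * hkey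

end Distribution

/-! ## The named fact, discharged -/

section Holds

variable {N : ℕ} {p : ℕ} [Fact p.Prime]

/-- **Discharge of `msdMeasureTame_distribution`** (Mazur–Tate–Teitelbaum §I.10 Prop. (10.2) at tame level `m`): for a
rational normalised newform `f` of level `N` prime to `p`, `(m, p) = 1`, `a_p(f) = a_p`, `α ≠ 0` with `α² − a_p α + p = 0`,
`∑_{a' ↦ a} μ_{f,α,m}((a' + pⁿ⁺¹ℤ_p) × {b}) = μ_{f,α,m}((a + pⁿℤ_p) × {b})`.
[cite: MazurTateTeitelbaum1986Invent, §I.10 Prop. (10.2) (p. 13)] -/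
theorem msdMeasureTame_distribution_holds : msdMeasureTame_distribution (N := N) (p := p) := by
  intro _ f hf hQ hpN m _ hmp ap hap α hα₀ hα n a b
  exact sum_filter_msdMeasureTame_succ f hf (ratCast_ratPlusSymbol_holds hf hQ) hpN hmp hap hα₀ hα n a b

end Holds

end Literature.NumberTheory.EllipticCurves

end
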